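import Mathlib.LinearAlgebra.Pi
import Mathlib.LinearAlgebra.Matrix.ToLinearEquiv
import Mathlib.LinearAlgebra.Matrix.Adjugate
import Mathlib.Algebra.Algebra.Subalgebra.Basic
import Mathlib.RingTheory.Ideal.Span
import Mathlib.Tactic.Module
import HarnessLib

/-!
# Subalgebras of `End(R²)` realising every line: a `2 × 2` density theorem

Pure linear algebra over a commutative domain `R`, on the free module `R²` (`Fin 2 → R`), serving
the elliptic-curve case of Tate's theorem on endomorphisms of abelian varieties over finite fields
(`Literature.AlgebraicGeometry.Motives.FaltingsEC`,
`Literature.AlgebraicGeometry.Motives.mem_span_range_tateModule_map_of_equivariant_of_finite`): there `R = ℤ_ℓ`, `R² ≅ T_ℓ E`,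
`M` is the `ℤ_ℓ`-span of the Tate-module maps of the endomorphisms of `E` and `𝓡` the set of those
maps. The file isolates the two pieces of `2 × 2` linear algebra in Tate's proof (Tate, Invent.
Math. 2 (1966), §2, Proposition 2 and Lemma 4) in an integral form (conclusions "`d • g ∈ M` for
some `d ≠ 0`" instead of statements over the fraction field):

* `Literature.AlgebraicGeometry.Motives.FinTwo.exists_smul_eq_of_commute`: if `θ ∈ End(R²)` has a cyclic vector `z` (`z, θ z`
  independent, i.e. `det(z, θ z) ≠ 0`) then every `u` commuting with `θ` satisfies
  `det(z, θ z) • u = α • 1 + β • θ`; `Literature.AlgebraicGeometry.Motives.FinTwo.exists_det_apply_ne_zero`: a non-scalar `θ` has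
  such a `z`; hence the commutant of a non-scalar endomorphism of `R²` is commutative
  (`Literature.AlgebraicGeometry.Motives.FinTwo.commute_of_commute`). (Tate, loc. cit., end of §2: `F_ℓ = ℚ_ℓ ⊗ ℚ(π)` is its own
  commutant when `π` is not a scalar.)
* `Literature.AlgebraicGeometry.Motives.FinTwo.exists_smul_mem_of_forall_exists_range_le` (**density**): let `M ⊆ End(R²)` be a
  subalgebra spanned by a subset `𝓡 ⊆ M` which is closed under products and differences and whose
  non-zero elements are injective, and suppose that for every `v ≠ 0` some non-zero `u ∈ M` has
  image in `R ∙ v` (Tate's Proposition 1: every `G`-line is `u V` for some `u ∈ E_ℓ`). Then for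
  every `g ∈ End(R²)` some non-zero multiple `d • g` lies in `M` (Tate's Proposition 2 with
  Lemma 4: the commutant `D` of `E_ℓ` stabilises every line, so `D` is the scalars and `E_ℓ` is
  everything, `E_ℓ` being semisimple). The semisimplicity input of Lemma 4 is replaced here by the
  hypothesis on `𝓡` (for an elliptic curve: a non-zero endomorphism is an isogeny, so its
  Tate-module map is injective), through the elementary argument: `M` is not commutative (three
  lines `R e₀`, `R e₁`, `R (e₀ + e₁)`); an `M`-stable line would give an injective ring map
  `𝓡 → R`, making `𝓡` and `M` commutative; and then the Jacobson-density computation for the simple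
  `M`-module `R²` (whose `M`-endomorphisms are scalars, again by non-commutativity).

All determinants are written out: `det(x, y) = x 0 * y 1 - x 1 * y 0`.

## References

* [Tate1966Endomorphisms] J. Tate, *Endomorphisms of abelian varieties over finite fields*,
  Invent. Math. 2 (1966), 134–144, §1 Lemma 4, §2 Propositions 1–2.
* N. Jacobson, *Basic Algebra II*, 2nd ed., §4.3 (density theorem). [folklore]
-/

namespace Literature.AlgebraicGeometry.Motives.FinTwo

variable {R : Type*} [CommRing R]

/-! ## Cramer's rule on `R²` -/

/-- Cramer's rule on `R²`: `det(x, y) • z = det(z, y) • x + det(x, z) • y`. [folklore] -/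
theorem det_smul_eq (x y z : Fin 2 → R) :
    (x 0 * y 1 - x 1 * y 0) • z = (z 0 * y 1 - z 1 * y 0) • x + (x 0 * z 1 - x 1 * z 0) • y := by
  ext i
  fin_cases i <;> simp <;> ring

/-- A linear map on `R²` killing two vectors `x, y` kills `det(x, y) • z` for every `z`.
[folklore] -/
theorem apply_det_smul_eq_zero {N : Type*} [AddCommGroup N] [Module R N]
    (φ : (Fin 2 → R) →ₗ[R] N) {x y : Fin 2 → R} (hx : φ x = 0) (hy : φ y = 0) (z : Fin 2 → R) :
    φ ((x 0 * y 1 - x 1 * y 0) • z) = 0 := by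
  rw [det_smul_eq, map_add, map_smul, map_smul, hx, hy, smul_zero, smul_zero, add_zero]

variable [IsDomain R]

/-- Over a domain, a linear map on `R²` into a torsion-free module killing two independent vectors
(`det(x, y) ≠ 0`) is zero. [folklore] -/
theorem eq_zero_of_apply_eq_zero {N : Type*} [AddCommGroup N] [Module R N] [Module.IsTorsionFree R N]
    (φ : (Fin 2 → R) →ₗ[R] N) {x y : Fin 2 → R} (hD : x 0 * y 1 - x 1 * y 0 ≠ 0) (hx : φ x = 0)
    (hy : φ y = 0) : φ = 0 := by
  refine LinearMap.ext fun z ↦ ?_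
  have h := apply_det_smul_eq_zero φ hx hy z
  rw [map_smul] at h
  exact (smul_eq_zero.mp h).resolve_left hD

/-- Two linear maps on `R²` (values in a torsion-free module) agreeing on two independent vectors
are equal. [folklore] -/
theorem eq_of_apply_eq {N : Type*} [AddCommGroup N] [Module R N] [Module.IsTorsionFree R N]
    {φ ψ : (Fin 2 → R) →ₗ[R] N} {x y : Fin 2 → R} (hD : x 0 * y 1 - x 1 * y 0 ≠ 0)
    (hx : φ x = ψ x) (hy : φ y = ψ y) : φ = ψ := by
  rw [← sub_eq_zero]
  exact eq_zero_of_apply_eq_zero _ hD (by rw [LinearMap.sub_apply, hx, sub_self])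
    (by rw [LinearMap.sub_apply, hy, sub_self])

/-- If `det(w, y) = 0` and `w ≠ 0` then `y` is a rational multiple of `w`: `d • y = c • w` with
`d ≠ 0`. [folklore] -/
theorem exists_smul_eq_smul_of_det_eq_zero {w y : Fin 2 → R} (h : w 0 * y 1 - w 1 * y 0 = 0)
    (hw : w ≠ 0) : ∃ d c : R, d ≠ 0 ∧ d • y = c • w := by
  by_cases h0 : w 0 = 0
  · have h1 : w 1 ≠ 0 := by
      contrapose! hw
      ext i; fin_cases i <;> simp [h0, hw]
    rw [h0, zero_mul, zero_sub, neg_eq_zero] at h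
    refine ⟨w 1, y 1, h1, ?_⟩
    ext i
    fin_cases i
    · simpa [h0] using h
    · simp only [Fin.mk_one, Fin.isValue, Pi.smul_apply, smul_eq_mul]
      ring
  · refine ⟨w 0, y 0, h0, ?_⟩
    ext i
    fin_cases i
    · simp only [Fin.zero_eta, Fin.isValue, Pi.smul_apply, smul_eq_mul]
      ring
    · simp only [Fin.mk_one, Fin.isValue, Pi.smul_apply, smul_eq_mul]
      rw [sub_eq_zero] at h
      rw [h, mul_comm]

/-! ## The commutant of a non-scalar endomorphism of `R²` -/

omit [IsDomain R] in
/-- A non-scalar endomorphism `θ` of `R²` has a cyclic vector among `e₀, e₁, e₀ + e₁`: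
some `z` with `det(z, θ z) ≠ 0`. [folklore] -/
theorem exists_det_apply_ne_zero {θ : Module.End R (Fin 2 → R)} (hθ : ∀ c : R, θ ≠ c • 1) :
    ∃ z : Fin 2 → R, z 0 * θ z 1 - z 1 * θ z 0 ≠ 0 := by
  by_contra! h
  have h0 := h (Pi.single 0 1)
  have h1 := h (Pi.single 1 1)
  have h2 := h (Pi.single 0 1 + Pi.single 1 1)
  simp only [map_add, Pi.add_apply] at h2
  simp at h0 h1 h2
  rw [h0, h1] at h2
  -- `θ e₀ = c e₀`, `θ e₁ = c e₁` with `c = θ e₀ 0 = θ e₁ 1`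
  refine hθ (θ (Pi.single 0 1) 0) (LinearMap.pi_ext' fun i ↦ LinearMap.ext_ring ?_)
  have key : ∀ v : Fin 2 → R, (θ (Pi.single 0 1) 0 • (1 : Module.End R (Fin 2 → R))) v =
      θ (Pi.single 0 1) 0 • v := fun v ↦ rfl
  fin_cases i
  · simp only [LinearMap.coe_comp, Function.comp_apply, LinearMap.coe_single, key]
    ext j
    fin_cases j
    · simp
    · simpa using h0
  · simp only [LinearMap.coe_comp, Function.comp_apply, LinearMap.coe_single, key]
    ext j
    fin_cases j
    · simpa using h1
    · simp only [Fin.mk_one, Fin.isValue, Pi.smul_apply, smul_eq_mul]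
      simpa using sub_eq_zero.mp h2

/-- **The commutant of an endomorphism with a cyclic vector.** If `u` commutes with `θ`, then
`det(z, θ z) • u = α • 1 + β • θ` for some `α, β ∈ R` (the Cramer coordinates of `u z` with
respect to `z, θ z`); this is informative when `det(z, θ z) ≠ 0`. Tate, Invent. Math. 2 (1966),
end of §2 (the commutant of `F_ℓ = ℚ_ℓ[π]`). [folklore] -/
theorem exists_smul_eq_of_commute {θ u : Module.End R (Fin 2 → R)} (z : Fin 2 → R)
    (hD : z 0 * θ z 1 - z 1 * θ z 0 ≠ 0) (h : u * θ = θ * u) :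
    ∃ α β : R, (z 0 * θ z 1 - z 1 * θ z 0) • u = α • 1 + β • θ := by
  refine ⟨u z 0 * θ z 1 - u z 1 * θ z 0, z 0 * u z 1 - z 1 * u z 0, ?_⟩
  -- both sides agree on `z` and on `θ z`
  have hz : ((z 0 * θ z 1 - z 1 * θ z 0) • u) z =
      ((u z 0 * θ z 1 - u z 1 * θ z 0) • (1 : Module.End R (Fin 2 → R)) +
        (z 0 * u z 1 - z 1 * u z 0) • θ) z := by
    rw [LinearMap.smul_apply, LinearMap.add_apply, LinearMap.smul_apply, LinearMap.smul_apply,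
      Module.End.one_apply]
    exact det_smul_eq z (θ z) (u z)
  refine eq_of_apply_eq hD hz ?_
  have hcomm : ∀ v, u (θ v) = θ (u v) := fun v ↦ by
    rw [← Module.End.mul_apply, h, Module.End.mul_apply]
  have hz' : (z 0 * θ z 1 - z 1 * θ z 0) • u z =
      (u z 0 * θ z 1 - u z 1 * θ z 0) • z + (z 0 * u z 1 - z 1 * u z 0) • θ z :=
    det_smul_eq z (θ z) (u z)
  rw [LinearMap.smul_apply, LinearMap.add_apply, LinearMap.smul_apply, LinearMap.smul_apply,
    Module.End.one_apply, hcomm, ← map_smul, hz', map_add, map_smul, map_smul]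

/-- **The commutant of a non-scalar endomorphism of `R²` is commutative** (it is `Frac(R)[θ]`
intersected with `End(R²)`). Tate, Invent. Math. 2 (1966), end of §2. [folklore] -/
theorem commute_of_commute {θ u u' : Module.End R (Fin 2 → R)} (hθ : ∀ c : R, θ ≠ c • 1)
    (hu : u * θ = θ * u) (hu' : u' * θ = θ * u') : u * u' = u' * u := by
  obtain ⟨z, hD⟩ := exists_det_apply_ne_zero hθ
  obtain ⟨α, β, hαβ⟩ := exists_smul_eq_of_commute z hD hu
  obtain ⟨α', β', hαβ'⟩ := exists_smul_eq_of_commute z hD hu'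
  set δ := z 0 * θ z 1 - z 1 * θ z 0 with hδ
  have h1 : (δ * δ) • (u * u') = (δ • u) * (δ • u') := by
    rw [mul_smul, smul_mul_assoc, mul_smul_comm]
  have h2 : (δ * δ) • (u' * u) = (δ • u') * (δ • u) := by
    rw [mul_smul, smul_mul_assoc, mul_smul_comm]
  have h3 : (δ • u) * (δ • u') = (δ • u') * (δ • u) := by
    rw [hαβ, hαβ']
    simp only [add_mul, mul_add, smul_mul_assoc, mul_smul_comm, one_mul, mul_one]
    module
  have h4 : (δ * δ) • (u * u' - u' * u) = 0 := by rw [smul_sub, h1, h2, h3, sub_self]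
  rwa [smul_eq_zero, or_iff_right (mul_ne_zero hD hD), sub_eq_zero] at h4


/-! ## Density for subalgebras of `End(R²)` realising every line -/

omit [IsDomain R] in
/-- The standard basis vector `e₀ = (1, 0)` of `R²` is non-zero. [folklore] -/
theorem single_zero_ne_zero [Nontrivial R] : (Pi.single (0 : Fin 2) (1 : R) : Fin 2 → R) ≠ 0 :=
  fun h ↦ absurd (by simpa using congr_fun h 0 : (1 : R) = 0) one_ne_zero

omit [IsDomain R] in
/-- The standard basis vector `e₁ = (0, 1)` of `R²` is non-zero. [folklore] -/
theorem single_one_ne_zero [Nontrivial R] : (Pi.single (1 : Fin 2) (1 : R) : Fin 2 → R) ≠ 0 :=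
  fun h ↦ absurd (by simpa using congr_fun h 1 : (1 : R) = 0) one_ne_zero

omit [IsDomain R] in
/-- A linear map on `R²` vanishing on `e₀` and `e₁` is zero. [folklore] -/
theorem eq_zero_of_apply_single_eq_zero {N : Type*} [AddCommGroup N] [Module R N]
    {φ : (Fin 2 → R) →ₗ[R] N} (h0 : φ (Pi.single 0 1) = 0) (h1 : φ (Pi.single 1 1) = 0) :
    φ = 0 := by
  refine LinearMap.pi_ext' fun i ↦ LinearMap.ext_ring ?_
  fin_cases i
  · simpa using h0
  · simpa using h1

/-- **Step 1: a subalgebra of `End(R²)` realising the three lines `R e₀`, `R e₁`, `R (e₀ + e₁)`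
as images of non-zero elements is not commutative.** If `u₁, u₂, u₃ ∈ M` are non-zero with
images in these lines and `M` is commutative, then `u₁ u₂ = u₂ u₁` has image in
`R e₀ ∩ R e₁ = 0`, so `u₁` kills the image of `u₂`, whence `u₁ e₁ = 0`; likewise
`u₁ (e₀ + e₁) = 0`, so `u₁ = 0`. (Tate, Invent. Math. 2 (1966), §2, proof of Proposition 2:
the commutant stabilises every line.) [folklore] -/
theorem exists_mul_ne_mul_of_forall_exists_range_le (M : Subalgebra R (Module.End R (Fin 2 → R)))
    (hP1 : ∀ v : Fin 2 → R, v ≠ 0 → ∃ u ∈ M, u ≠ 0 ∧ ∀ x, u x ∈ R ∙ v) :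
    ∃ u ∈ M, ∃ u' ∈ M, u * u' ≠ u' * u := by
  by_contra! hcomm
  obtain ⟨u₁, hu₁M, hu₁, hu₁r⟩ := hP1 (Pi.single (0 : Fin 2) (1 : R)) single_zero_ne_zero
  obtain ⟨u₂, hu₂M, hu₂, hu₂r⟩ := hP1 (Pi.single (1 : Fin 2) (1 : R)) single_one_ne_zero
  obtain ⟨u₃, hu₃M, hu₃, hu₃r⟩ := hP1 (Pi.single (0 : Fin 2) (1 : R) + Pi.single (1 : Fin 2) (1 : R))
    (fun h ↦ absurd (by simpa using congr_fun h 0 : (1 : R) = 0) one_ne_zero)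
  -- `u₁ u₂ = 0` and `u₁ u₃ = 0`
  have h12 : ∀ x, u₁ (u₂ x) = 0 := fun x ↦ by
    obtain ⟨a, ha⟩ := Submodule.mem_span_singleton.mp (hu₁r (u₂ x))
    obtain ⟨b, hb⟩ := Submodule.mem_span_singleton.mp (hu₂r (u₁ x))
    have hab : a • (Pi.single 0 1 : Fin 2 → R) = b • Pi.single 1 1 := by
      rw [ha, hb, ← Module.End.mul_apply, hcomm u₁ hu₁M u₂ hu₂M, Module.End.mul_apply]
    have ha0 : a = 0 := by simpa using congr_fun hab 0
    rw [← ha, ha0, zero_smul]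
  have h13 : ∀ x, u₁ (u₃ x) = 0 := fun x ↦ by
    obtain ⟨a, ha⟩ := Submodule.mem_span_singleton.mp (hu₁r (u₃ x))
    obtain ⟨b, hb⟩ := Submodule.mem_span_singleton.mp (hu₃r (u₁ x))
    have hab : a • (Pi.single 0 1 : Fin 2 → R) = b • (Pi.single 0 1 + Pi.single 1 1) := by
      rw [ha, hb, ← Module.End.mul_apply, hcomm u₁ hu₁M u₃ hu₃M, Module.End.mul_apply]
    have hb0 : b = 0 := by simpa using (congr_fun hab 1).symm
    rw [← Module.End.mul_apply, hcomm u₁ hu₁M u₃ hu₃M, Module.End.mul_apply, ← hb, hb0,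
      zero_smul]
  -- `u₁` kills `e₁` and `e₀ + e₁`
  have hkill : ∀ {u : Module.End R (Fin 2 → R)} {v : Fin 2 → R}, u ≠ 0 → (∀ x, u x ∈ R ∙ v) →
      (∀ x, u₁ (u x) = 0) → u₁ v = 0 := by
    intro u v hu hur h
    obtain ⟨x, hx⟩ : ∃ x, u x ≠ 0 := by
      by_contra! h0
      exact hu (LinearMap.ext h0)
    obtain ⟨r, hr⟩ := Submodule.mem_span_singleton.mp (hur x)
    have hr0 : r ≠ 0 := by
      rintro rfl
      exact hx (by rw [← hr, zero_smul])
    have := h x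
    rw [← hr, map_smul] at this
    exact (smul_eq_zero.mp this).resolve_left hr0
  have h1 : u₁ (Pi.single 1 1) = 0 := hkill hu₂ hu₂r h12
  have h01 : u₁ (Pi.single 0 1 + Pi.single 1 1) = 0 := hkill hu₃ hu₃r h13
  have h0 : u₁ (Pi.single 0 1) = 0 := by rwa [map_add, h1, add_zero] at h01
  exact hu₁ (eq_zero_of_apply_single_eq_zero h0 h1)

omit [IsDomain R] in
/-- The `R`-span of a set of pairwise commuting endomorphisms is commutative. [folklore] -/
theorem mul_comm_of_mem_span {A : Type*} [Ring A] [Algebra R A] {𝓡 : Set A}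
    (h : ∀ r ∈ 𝓡, ∀ s ∈ 𝓡, r * s = s * r) {u u' : A} (hu : u ∈ Submodule.span R 𝓡)
    (hu' : u' ∈ Submodule.span R 𝓡) : u * u' = u' * u := by
  induction hu using Submodule.span_induction with
  | mem r hr =>
    induction hu' using Submodule.span_induction with
    | mem s hs => exact h r hr s hs
    | zero => rw [mul_zero, zero_mul]
    | add x y _ _ hx hy => rw [mul_add, add_mul, hx, hy]
    | smul a x _ hx => rw [mul_smul_comm, smul_mul_assoc, hx]
  | zero => rw [mul_zero, zero_mul]
  | add x y _ _ hx hy => rw [add_mul, mul_add, hx, hy]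
  | smul a x _ hx => rw [smul_mul_assoc, mul_smul_comm, hx]

omit [IsDomain R] in
/-- If `d • y = c • w` and `d' • y' = c' • w`, then for endomorphisms `r, s` with `r w = y`-type
relations the commutator kills `w`; packaged as: `(d * d') • (r (s w)) = (c' * c) • w` whenever
`d • r w = c • w` and `d' • s w = c' • w`. [folklore] -/
theorem mul_smul_apply_apply_eq {r s : Module.End R (Fin 2 → R)} {w : Fin 2 → R} {d c d' c' : R}
    (hdc : d • r w = c • w) (hdc' : d' • s w = c' • w) :
    (d * d') • r (s w) = (c' * c) • w := by
  rw [mul_smul, ← map_smul r d', hdc', map_smul, smul_comm d c', hdc, ← mul_smul]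

/-- **Step 2: no `M`-stable line.** Let `M ⊆ End(R²)` be a non-commutative subalgebra spanned by
a subset `𝓡 ⊆ M` closed under products and differences whose non-zero elements kill no non-zero
vector. Then for every `w ≠ 0` some `u ∈ M` moves the line of `w`: `det(w, u w) ≠ 0`. (If `M`
stabilised the line `Frac(R) w`, then `r w = λ_r w` for `r ∈ 𝓡`, so every commutator
`r s - s r ∈ 𝓡` kills `w`, hence vanishes: `𝓡`, and with it `M`, would be commutative.)
Tate, Invent. Math. 2 (1966), §1 Lemma 4 and §2 Proposition 2 (where semisimplicity of `E_ℓ`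
plays this role). [folklore] -/
theorem exists_det_apply_ne_zero_of_ne_zero (M : Subalgebra R (Module.End R (Fin 2 → R)))
    (𝓡 : Set (Module.End R (Fin 2 → R))) (hM𝓡 : ∀ u ∈ M, u ∈ Submodule.span R 𝓡)
    (h𝓡M : 𝓡 ⊆ M) (h𝓡mul : ∀ r ∈ 𝓡, ∀ s ∈ 𝓡, r * s ∈ 𝓡)
    (h𝓡sub : ∀ r ∈ 𝓡, ∀ s ∈ 𝓡, r - s ∈ 𝓡)
    (h𝓡inj : ∀ r ∈ 𝓡, ∀ w : Fin 2 → R, w ≠ 0 → r w = 0 → r = 0)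
    (hnc : ∃ u ∈ M, ∃ u' ∈ M, u * u' ≠ u' * u) {w : Fin 2 → R} (hw : w ≠ 0) :
    ∃ u ∈ M, w 0 * u w 1 - w 1 * u w 0 ≠ 0 := by
  by_contra! hline
  have hcomm𝓡 : ∀ r ∈ 𝓡, ∀ s ∈ 𝓡, r * s = s * r := by
    intro r hr s hs
    obtain ⟨d, c, hd, hdc⟩ := exists_smul_eq_smul_of_det_eq_zero (hline r (h𝓡M hr)) hw
    obtain ⟨d', c', hd', hdc'⟩ := exists_smul_eq_smul_of_det_eq_zero (hline s (h𝓡M hs)) hw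
    have htw : (r * s - s * r) w = 0 := by
      have h1 : (d * d') • r (s w) = (c' * c) • w := mul_smul_apply_apply_eq hdc hdc'
      have h2 : (d' * d) • s (r w) = (c * c') • w := mul_smul_apply_apply_eq hdc' hdc
      have : (d * d') • ((r * s - s * r) w) = 0 := by
        rw [LinearMap.sub_apply, Module.End.mul_apply, Module.End.mul_apply, smul_sub, h1,
          mul_comm d d', h2, mul_comm c' c, sub_self]
      exact (smul_eq_zero.mp this).resolve_left (mul_ne_zero hd hd')
    exact sub_eq_zero.mp
      (h𝓡inj _ (h𝓡sub _ (h𝓡mul r hr s hs) _ (h𝓡mul s hs r hr)) w hw htw)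
  obtain ⟨u, hu, u', hu', hne⟩ := hnc
  exact hne (mul_comm_of_mem_span hcomm𝓡 (hM𝓡 u hu) (hM𝓡 u' hu'))

/-- **Step 3: the annihilator of `x` in `M` moves `y` in two independent directions.** Under the
hypotheses of `exists_det_apply_ne_zero_of_ne_zero`, for independent `x, y ∈ R²`
(`det(x, y) ≠ 0`) there are `u₁, u₂ ∈ M` killing `x` with `u₁ y, u₂ y` independent. This is the
Jacobson density computation for the `M`-module `R²`: if every `u ∈ M` killing `x` killed `y`,
then `u x ↦ u y` would extend to an `M`-endomorphism `θ` of `R²` with `θ x = δ • y` (`δ ≠ 0`),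
which is not a scalar, so that `M`, lying in the commutant of `θ`, would be commutative; and if
these `u y` spanned only a line, that line would be `M`-stable. [folklore] -/
theorem exists_annihilator_det_ne_zero (M : Subalgebra R (Module.End R (Fin 2 → R)))
    (𝓡 : Set (Module.End R (Fin 2 → R))) (hM𝓡 : ∀ u ∈ M, u ∈ Submodule.span R 𝓡)
    (h𝓡M : 𝓡 ⊆ M) (h𝓡mul : ∀ r ∈ 𝓡, ∀ s ∈ 𝓡, r * s ∈ 𝓡)
    (h𝓡sub : ∀ r ∈ 𝓡, ∀ s ∈ 𝓡, r - s ∈ 𝓡)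
    (h𝓡inj : ∀ r ∈ 𝓡, ∀ w : Fin 2 → R, w ≠ 0 → r w = 0 → r = 0)
    (hnc : ∃ u ∈ M, ∃ u' ∈ M, u * u' ≠ u' * u) {x y : Fin 2 → R}
    (hD : x 0 * y 1 - x 1 * y 0 ≠ 0) :
    ∃ u₁ ∈ M, ∃ u₂ ∈ M, u₁ x = 0 ∧ u₂ x = 0 ∧
      u₁ y 0 * u₂ y 1 - u₁ y 1 * u₂ y 0 ≠ 0 := by
  have hx : x ≠ 0 := by
    rintro rfl
    simp at hD
  by_cases hN : ∃ u ∈ M, u x = 0 ∧ u y ≠ 0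
  · obtain ⟨u, hu, hux, huy⟩ := hN
    obtain ⟨u', hu', hD'⟩ :=
      exists_det_apply_ne_zero_of_ne_zero M 𝓡 hM𝓡 h𝓡M h𝓡mul h𝓡sub h𝓡inj hnc huy
    refine ⟨u, hu, u' * u, M.mul_mem hu' hu, hux, ?_, ?_⟩
    · rw [Module.End.mul_apply, hux, map_zero]
    · rwa [Module.End.mul_apply]
  · push Not at hN
    exfalso
    obtain ⟨a, ha, hδ⟩ :=
      exists_det_apply_ne_zero_of_ne_zero M 𝓡 hM𝓡 h𝓡M h𝓡mul h𝓡sub h𝓡inj hnc hx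
    set δ := x 0 * a x 1 - x 1 * a x 0 with hδdef
    -- Cramer coordinates with respect to `x, a x`, as linear functionals
    set p : (Fin 2 → R) →ₗ[R] R :=
      a x 1 • LinearMap.proj 0 - a x 0 • LinearMap.proj 1 with hp
    set q : (Fin 2 → R) →ₗ[R] R := x 0 • LinearMap.proj 1 - x 1 • LinearMap.proj 0 with hq
    have hp_apply : ∀ z : Fin 2 → R, p z = z 0 * a x 1 - z 1 * a x 0 := fun z ↦ by
      simp only [hp, LinearMap.sub_apply, LinearMap.smul_apply, LinearMap.proj_apply,
        smul_eq_mul]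
      ring
    have hq_apply : ∀ z : Fin 2 → R, q z = x 0 * z 1 - x 1 * z 0 := fun z ↦ by
      simp only [hq, LinearMap.sub_apply, LinearMap.smul_apply, LinearMap.proj_apply,
        smul_eq_mul]
    -- `δ • z = (p z + q z a) x`
    have hcramer : ∀ z : Fin 2 → R, δ • z = (p z • (1 : Module.End R (Fin 2 → R)) + q z • a) x :=
      fun z ↦ by
        rw [LinearMap.add_apply, LinearMap.smul_apply, LinearMap.smul_apply, Module.End.one_apply,
          hp_apply, hq_apply]
        exact det_smul_eq x (a x) z
    have hmemM : ∀ z : Fin 2 → R, p z • (1 : Module.End R (Fin 2 → R)) + q z • a ∈ M := fun z ↦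
      M.add_mem (M.smul_mem M.one_mem _) (M.smul_mem ha _)
    -- the endomorphism `θ z = (p z + q z a) y`
    set θ : Module.End R (Fin 2 → R) := p.smulRight y + q.smulRight (a y) with hθ
    have hθ_apply : ∀ z, θ z = (p z • (1 : Module.End R (Fin 2 → R)) + q z • a) y := fun z ↦ by
      simp only [hθ, LinearMap.add_apply, LinearMap.smulRight_apply, LinearMap.smul_apply,
        Module.End.one_apply]
    -- `θ` commutes with `M`
    have hθcomm : ∀ u ∈ M, u * θ = θ * u := by
      intro u hu
      refine LinearMap.ext fun z ↦ ?_
      rw [Module.End.mul_apply, Module.End.mul_apply, hθ_apply, hθ_apply]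
      -- `(u (p z + q z a) - (p (u z) + q (u z) a)) x = 0`, hence the same with `y`
      have hx0 : (u * (p z • (1 : Module.End R (Fin 2 → R)) + q z • a) -
          (p (u z) • (1 : Module.End R (Fin 2 → R)) + q (u z) • a)) x = 0 := by
        rw [LinearMap.sub_apply, Module.End.mul_apply, ← hcramer, ← hcramer, map_smul, sub_self]
      have hy0 := hN _ (M.sub_mem (M.mul_mem hu (hmemM z)) (hmemM (u z))) hx0
      rw [LinearMap.sub_apply, Module.End.mul_apply, sub_eq_zero] at hy0
      exact hy0
    -- `θ x = δ • y`
    have hθx : θ x = δ • y := by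
      rw [hθ_apply]
      have hx0 : ((p x • (1 : Module.End R (Fin 2 → R)) + q x • a) -
          δ • (1 : Module.End R (Fin 2 → R))) x = 0 := by
        rw [LinearMap.sub_apply, ← hcramer, LinearMap.smul_apply, Module.End.one_apply, sub_self]
      have hy0 := hN _ (M.sub_mem (hmemM x) (M.smul_mem M.one_mem _)) hx0
      rw [LinearMap.sub_apply, sub_eq_zero, LinearMap.smul_apply, Module.End.one_apply] at hy0
      exact hy0
    -- `θ` is not a scalar
    have hθns : ∀ c : R, θ ≠ c • 1 := by
      intro c hc
      have h1 : θ x = c • x := by rw [hc, LinearMap.smul_apply, Module.End.one_apply]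
      rw [hθx] at h1
      -- `det(x, δ • y) = δ * det(x, y) ≠ 0` but `det(x, c • x) = 0`
      have h2 : x 0 * (δ • y) 1 - x 1 * (δ • y) 0 = δ * (x 0 * y 1 - x 1 * y 0) := by
        simp only [Pi.smul_apply, smul_eq_mul]
        ring
      have h3 : x 0 * (c • x) 1 - x 1 * (c • x) 0 = 0 := by
        simp only [Pi.smul_apply, smul_eq_mul]
        ring
      rw [h1, h3] at h2
      exact mul_ne_zero hδ hD h2.symm
    -- hence `M` is commutative: contradiction
    obtain ⟨u, hu, u', hu', hne⟩ := hnc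
    exact hne (commute_of_commute hθns (hθcomm u hu) (hθcomm u' hu'))

/-- **Density for subalgebras of `End(R²)` realising every line** (the `2 × 2` linear algebra of
Tate, Invent. Math. 2 (1966), §2 Proposition 2 with §1 Lemma 4, integral form). Let `R` be a
domain and `M ⊆ End_R(R²)` a subalgebra which is the `R`-span of a subset `𝓡 ⊆ M` closed under
products and differences all of whose non-zero elements kill no non-zero vector (for an elliptic
curve: the Tate-module maps of its endomorphisms, which are `0` or isogenies). Suppose that for
every `v ≠ 0` there is a non-zero `u ∈ M` with `u(R²) ⊆ R ∙ v` (the conclusion of Tate's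
Proposition 1 for the line through `v`). Then every `g ∈ End_R(R²)` has a non-zero multiple
`d • g ∈ M`, i.e. `M` spans `End(Frac(R)²)`: prescribe `d • g` on the basis `e₀, a e₀`
(`a ∈ M` moving the line `R e₀`, Step 2) using the annihilators of `a e₀` and of `e₀` in `M`
(Step 3). [cite: Tate1966Endomorphisms, §2 Proposition 2] -/
theorem exists_smul_mem_of_forall_exists_range_le (M : Subalgebra R (Module.End R (Fin 2 → R)))
    (𝓡 : Set (Module.End R (Fin 2 → R))) (hM𝓡 : ∀ u ∈ M, u ∈ Submodule.span R 𝓡)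
    (h𝓡M : 𝓡 ⊆ M) (h𝓡mul : ∀ r ∈ 𝓡, ∀ s ∈ 𝓡, r * s ∈ 𝓡)
    (h𝓡sub : ∀ r ∈ 𝓡, ∀ s ∈ 𝓡, r - s ∈ 𝓡)
    (h𝓡inj : ∀ r ∈ 𝓡, ∀ w : Fin 2 → R, w ≠ 0 → r w = 0 → r = 0)
    (hP1 : ∀ v : Fin 2 → R, v ≠ 0 → ∃ u ∈ M, u ≠ 0 ∧ ∀ x, u x ∈ R ∙ v)
    (g : Module.End R (Fin 2 → R)) : ∃ d : R, d ≠ 0 ∧ d • g ∈ M := by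
  have hnc := exists_mul_ne_mul_of_forall_exists_range_le M hP1
  set e : Fin 2 → R := Pi.single 0 1 with he
  have he0 : e ≠ 0 := single_zero_ne_zero
  obtain ⟨a, ha, hδ⟩ :=
    exists_det_apply_ne_zero_of_ne_zero M 𝓡 hM𝓡 h𝓡M h𝓡mul h𝓡sub h𝓡inj hnc he0
  have hδ' : a e 0 * e 1 - a e 1 * e 0 ≠ 0 := by
    rw [← neg_ne_zero]
    convert hδ using 1
    ring
  -- annihilators of `e` moving `a e`, and of `a e` moving `e`
  obtain ⟨u₁, hu₁, u₂, hu₂, hu₁e, hu₂e, hδ₂⟩ :=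
    exists_annihilator_det_ne_zero M 𝓡 hM𝓡 h𝓡M h𝓡mul h𝓡sub h𝓡inj hnc hδ
  obtain ⟨v₁, hv₁, v₂, hv₂, hv₁e, hv₂e, hδ₃⟩ :=
    exists_annihilator_det_ne_zero M 𝓡 hM𝓡 h𝓡M h𝓡mul h𝓡sub h𝓡inj hnc hδ'
  set δ₂ := u₁ (a e) 0 * u₂ (a e) 1 - u₁ (a e) 1 * u₂ (a e) 0 with hδ₂def
  set δ₃ := v₁ e 0 * v₂ e 1 - v₁ e 1 * v₂ e 0 with hδ₃def
  -- `b ∈ M` with `b (a e) = 0`, `b e = δ₃ • g e`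
  set b : Module.End R (Fin 2 → R) :=
    (g e 0 * v₂ e 1 - g e 1 * v₂ e 0) • v₁ + (v₁ e 0 * g e 1 - v₁ e 1 * g e 0) • v₂ with hb
  have hbM : b ∈ M := M.add_mem (M.smul_mem hv₁ _) (M.smul_mem hv₂ _)
  have hbae : b (a e) = 0 := by
    simp only [hb, LinearMap.add_apply, LinearMap.smul_apply, hv₁e, hv₂e, smul_zero, add_zero]
  have hbe : b e = δ₃ • g e := by
    simp only [hb, LinearMap.add_apply, LinearMap.smul_apply]
    exact (det_smul_eq (v₁ e) (v₂ e) (g e)).symm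
  -- `c ∈ M` with `c e = 0`, `c (a e) = δ₂ • g (a e)`
  set c : Module.End R (Fin 2 → R) :=
    (g (a e) 0 * u₂ (a e) 1 - g (a e) 1 * u₂ (a e) 0) • u₁ +
      (u₁ (a e) 0 * g (a e) 1 - u₁ (a e) 1 * g (a e) 0) • u₂ with hc
  have hcM : c ∈ M := M.add_mem (M.smul_mem hu₁ _) (M.smul_mem hu₂ _)
  have hce : c e = 0 := by
    simp only [hc, LinearMap.add_apply, LinearMap.smul_apply, hu₁e, hu₂e, smul_zero, add_zero]
  have hcae : c (a e) = δ₂ • g (a e) := by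
    simp only [hc, LinearMap.add_apply, LinearMap.smul_apply]
    exact (det_smul_eq (u₁ (a e)) (u₂ (a e)) (g (a e))).symm
  -- `(δ₂ δ₃) • g = δ₂ • b + δ₃ • c` (they agree on `e` and `a e`)
  refine ⟨δ₂ * δ₃, mul_ne_zero hδ₂ hδ₃, ?_⟩
  have key : (δ₂ * δ₃) • g = δ₂ • b + δ₃ • c := by
    refine eq_of_apply_eq hδ ?_ ?_
    · rw [LinearMap.smul_apply, LinearMap.add_apply, LinearMap.smul_apply, LinearMap.smul_apply,
        hbe, hce, smul_zero, add_zero, smul_smul]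
    · rw [LinearMap.smul_apply, LinearMap.add_apply, LinearMap.smul_apply, LinearMap.smul_apply,
        hbae, hcae, smul_zero, zero_add, smul_smul, mul_comm]
  rw [key]
  exact M.add_mem (M.smul_mem hbM _) (M.smul_mem hcM _)


/-! ## Quasi-inverses of injective endomorphisms of `R²` -/

/-- **An injective endomorphism of `R²` is invertible up to a non-zero scalar**: if
`g : R² → R²` is injective then `det g ≠ 0` and the adjugate `v` satisfies `g ∘ v = det g • id`,
`v ∘ g = det g • id`. (For the Tate-module map of an isogeny `φ₀ : E → E'` this produces the
`Γ`-equivariant quasi-inverse used to pass from `End` to `Hom` in Tate's theorem.) [folklore] -/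
theorem exists_comp_eq_smul_id_of_injective (g : Module.End R (Fin 2 → R))
    (hg : Function.Injective g) :
    ∃ d : R, d ≠ 0 ∧ ∃ v : Module.End R (Fin 2 → R), g * v = d • 1 ∧ v * g = d • 1 := by
  classical
  set P : Matrix (Fin 2) (Fin 2) R := LinearMap.toMatrix' g with hP
  have hgP : g = Matrix.toLin' P := by rw [hP, Matrix.toLin'_toMatrix']
  have hdet : P.det ≠ 0 := by
    intro h0
    obtain ⟨w, hw, hPw⟩ := Matrix.exists_mulVec_eq_zero_iff.mpr h0
    refine hw (hg ?_)
    rw [map_zero, hgP, Matrix.toLin'_apply, hPw]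
  refine ⟨P.det, hdet, Matrix.toLin' P.adjugate, ?_, ?_⟩
  · rw [hgP, Module.End.mul_eq_comp, ← Matrix.toLin'_mul, Matrix.mul_adjugate, map_smul,
      Matrix.toLin'_one]
    rfl
  · rw [hgP, Module.End.mul_eq_comp, ← Matrix.toLin'_mul, Matrix.adjugate_mul, map_smul,
      Matrix.toLin'_one]
    rfl

end Literature.AlgebraicGeometry.Motives.FinTwo
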